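import Literature.AlgebraicGeometry.GroupSchemes.UnitComponentOfFiniteGroupScheme
import HarnessLib

/-!
# Closer for `stub_b1a_unitComponent` of `Cruxes/HLiu418/Lines/F0_P6b_ConnectedEtale.lean` ED. 1 (σ1 «HOPF»)

Summit-side THEOREM file (cell `pub/hodgecm-mathlib`, FLOOR 0, P6 «MOD programme», sub-line P6b «CONNECTED–ÉTALE», desk F0P6b-plan (g0);
prover F0P6-p09 (g0), strategy σ1 «HOPF»; `--supports stmt-HodgeConjecture-24832` (HLiu418)).  ONE theorem, `stub_b1a_unitComponent`, whose
TYPE is the text of the stub `stub_b1a_unitComponent` (cand ED. 1, sha16 8210ab19d71568b2, :63–66) with the line's predicate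
`IsUnitComponent G G₀ j := IsMonHom j ∧ IsOpenImmersion j.left ∧ IsClosedImmersion j.left ∧ ConnectedSpace G₀.left` UNFOLDED (a
`Theorems` file may not import a `Cruxes/…/Lines` workfile); the desk folds `stub_b1a_unitComponent := <this>` by `exact` (δ-unfolding).
PROOF = ★ `Literature.AlgebraicGeometry.GroupSchemes.exists_unitComponent` (organ `GroupSchemes/UnitComponentOfFiniteGroupScheme`:
unit idempotent of the finite Hopf algebra `Γ(G, 𝒪_G)` over a henselian base ★ `Henselian.exists_unit_idempotent`, Hopf ideal `(1 − e)` ★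
`Henselian.isHopfIdeal_span_one_sub`, closed subgroup scheme ★ `AffineGroupScheme.exists_grpObj_isMonHom_quotIncl`, open because `e` is
idempotent, connected because the unit corner is local).  HC_CM is proved only modulo the printed citations until rung 0 closes; this
file changes no count.

## References
* [Tate1997FiniteFlatGroupSchemes] J. Tate, *Finite flat group schemes* (1997), (3.7) (I).
* [StacksProject] The Stacks Project, Tag 04GG.
-/

set_option autoImplicit false
set_option linter.dupNamespace false  -- `Summit.HodgeConjecture.HodgeConjecture.…` BY DESIGN (D-0017), as in every closer of this cell

noncomputable section

open CategoryTheory CategoryTheory.Limits AlgebraicGeometry MonoidalCategory CartesianMonoidalCategory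

namespace Summit.HodgeConjecture.HodgeConjecture.Cruxes.HLiu418.F0P6bConnectedEtaleStubB1a

/-- **`stub_b1a_unitComponent` (σ1 «HOPF»)** — a finite group scheme `G` over a HENSELIAN local ring `R` has a unit component: a group
object `G₀` of `Over (Spec R)` with a homomorphism `j : G₀ ⟶ G` whose underlying morphism is an open and closed immersion with connected
source (the text of the line's `IsUnitComponent G G₀ j`, unfolded).  Flatness is not needed.  `:=` ★ `GroupSchemes.exists_unitComponent`.
[cite: Tate1997FiniteFlatGroupSchemes, (3.7) (I) (p. 141)] [cite: StacksProject, Tag 04GG] -/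
theorem stub_b1a_unitComponent :
    ∀ (R : Type) [CommRing R] [HenselianLocalRing R] (G : Over (Spec (.of R))) [GrpObj G],
      IsFinite G.hom →
        ∃ (G₀ : Over (Spec (.of R))) (_ : GrpObj G₀) (j : G₀ ⟶ G),
          IsMonHom j ∧ IsOpenImmersion j.left ∧ IsClosedImmersion j.left ∧ ConnectedSpace ↥G₀.left :=
  fun R _ _ G _ hG =>
    haveI := hG
    Literature.AlgebraicGeometry.GroupSchemes.exists_unitComponent R G

end Summit.HodgeConjecture.HodgeConjecture.Cruxes.HLiu418.F0P6bConnectedEtaleStubB1a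

end
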